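import Literature.Topology.FourManifolds.OneHandlebodyFundamentalGroup
import HarnessLib

/-!
# The ball and the cores of a `1`-handlebody, for a given nice Morse function and field

Topic `Literature/Topology/FourManifolds` (fact seat
`provefact-Literature.Topology.FourManifolds.lauden-f709dd520c`, Laudenbach–Poénaru's Lemma 2:
the free basis `x₁, …, x_k` of `π₁` of a `1`-handlebody given by the cores of its `1`-handles,
p. 339 of the paper, must be built from the *same* Morse data as the handle slides realising
the Nielsen moves).  Everything here is **proved**; no named facts.

`IsMorseAdapted.exists_ball_union_arcs_isStrongDeformationRetractOf`
(`OneHandlebodyFundamentalGroup.lean`) chooses a nice Morse function and a gradient-like field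
internally and forgets them.  Here the same construction is run for a **given** nice Morse
function `g` on the triad `(W; ∅, ∂W)` and a **given** gradient-like field `ξ`
(`Cobordism.IsNiceMorseFunction.exists_ball_union_leftHandDiscs`), and the Morse meaning of the
output is recorded: the ball is the sublevel set `{g ≤ t₁}` just above the minimum `p₀`, the
arcs are the left-hand discs `D_L(q) = W^s(q) ∩ {g ≥ t₁}` of the index-`1` points `q`
(Milnor 1965, Def. 3.9) parametrised by closed unit `1`-balls with `g = t₁` exactly on their
end points, and `{g ≤ t₁} ∪ ⋃_q D_L(q)` is a strong deformation retract of `W` (Thm. 3.14).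

## References

* J. Milnor, *Lectures on the h-cobordism theorem* (1965), Def. 3.9, Thm. 3.14 and Remark
  (PDF pp. 19–21), Thm. 4.8. [MilnorHCobordism1965]
* J. Milnor, *Morse theory* (1963), Thm. 3.2, proof of Thm. 4.1 (p. 25). [Milnor1963]
* F. Laudenbach, V. Poénaru, Bull. Soc. Math. France 100 (1972), p. 339. [LaudenbachPoenaruBSMF1972]
-/

open scoped Manifold ContDiff Topology
open Set Function Filter Metric
open Literature.AlgebraicTopology Literature.AlgebraicTopology.FundamentalGroup

noncomputable section

namespace Literature.Topology.FourManifolds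

universe u

variable {n : ℕ} {W : Type u} [TopologicalSpace W] [T2Space W] [SecondCountableTopology W]
  [CompactSpace W] [ChartedSpace (EuclideanHalfSpace (n + 1)) W] [IsManifold (𝓡∂ (n + 1)) ∞ W]

/-- **The ball and the cores of a `1`-handlebody, for given Morse data** (Milnor 1963, Thm. 3.2
/ Milnor 1965, Thm. 3.14, as in `IsMorseAdapted.exists_ball_union_arcs_isStrongDeformationRetractOf`
but with the nice Morse function `g` and the gradient-like field `ξ` prescribed and the Morse
meaning of the output recorded).  Let `g` be a nice Morse function on the triad `(W; ∅, ∂W)` of a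
compact manifold with boundary `W` with exactly one critical point of index `0`, `m` of index `1`
and none of index `≥ 2`, and `ξ` a smooth gradient-like field for `g`.  Then there are the
minimum `p₀`, a level `t₁` with `g p₀ < t₁ < g q` for all index-`1` points `q` (`t₁ < 1`), an
injective continuous closed ball `β : D^{n+1} → W` onto `{g ≤ t₁}`, and for each index-`1` point
`q` an injective continuous arc `Φ q : D¹ → W` (`D¹` the closed unit ball of `ℝ¹`) onto the
left-hand disc `D_L(q)` down to the level `t₁`, with `g (Φ q x) = t₁ ↔ ‖x‖ = 1 ↔ Φ q x ∈ {g ≤ t₁}`,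
the arcs pairwise disjoint, such that `{g ≤ t₁} ∪ ⋃_q D_L(q)` is a strong deformation retract of
`W`. [cite: MilnorHCobordism1965, Thm. 3.14 and Remark (PDF pp. 19–21), Def. 3.9]
[cite: Milnor1963, Thm. 3.2 and proof of Thm. 4.1 (p. 25)] -/
theorem Cobordism.IsNiceMorseFunction.exists_ball_union_leftHandDiscs
    {g : (Cobordism.ofBoundary n W).W → ℝ} (hg : (Cobordism.ofBoundary n W).IsNiceMorseFunction g)
    (ξ : Cₛ^∞⟮𝓡∂ (n + 1); EuclideanSpace ℝ (Fin (n + 1)),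
      (TangentSpace (𝓡∂ (n + 1)) : (Cobordism.ofBoundary n W).W → Type)⟯)
    (hξ : IsGradientLike (𝓡∂ (n + 1)) g ξ) {m : ℕ}
    (h0 : (criticalSetOfIndex (𝓡∂ (n + 1)) g 0).ncard = 1)
    (h1 : (criticalSetOfIndex (𝓡∂ (n + 1)) g 1).ncard = m)
    (h2 : ∀ k, 2 ≤ k → (criticalSetOfIndex (𝓡∂ (n + 1)) g k).ncard = 0) :
    ∃ (p₀ : W) (t₁ : ℝ) (β : C(closedBall (0 : EuclideanSpace ℝ (Fin (n + 1))) 1, W))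
      (_ : Fintype ↥(criticalSetOfIndex (𝓡∂ (n + 1)) g 1))
      (Φ : ↥(criticalSetOfIndex (𝓡∂ (n + 1)) g 1) →
        C(closedBall (0 : EuclideanSpace ℝ (Fin 1)) 1, W)),
      criticalSetOfIndex (𝓡∂ (n + 1)) g 0 = {p₀} ∧ g p₀ < t₁ ∧ 0 < t₁ ∧ t₁ < 1 ∧
      (∀ q ∈ criticalSetOfIndex (𝓡∂ (n + 1)) g 1, t₁ < g q) ∧
      Injective β ∧ range β = g ⁻¹' Iic t₁ ∧
      Fintype.card ↥(criticalSetOfIndex (𝓡∂ (n + 1)) g 1) = m ∧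
      (∀ q, Injective (Φ q)) ∧
      (∀ q, range (Φ q) = leftHandDisc (𝓡∂ (n + 1)) g ξ q t₁) ∧
      (∀ q x, g (Φ q x) = t₁ ↔ ‖(x : EuclideanSpace ℝ (Fin 1))‖ = 1) ∧
      (∀ q x, Φ q x ∈ range β ↔ ‖(x : EuclideanSpace ℝ (Fin 1))‖ = 1) ∧
      (Pairwise fun q q' => Disjoint (range (Φ q)) (range (Φ q'))) ∧
      Homotopy.IsStrongDeformationRetractOf (range β ∪ ⋃ q, range (Φ q)) univ := by
  classical
  haveI : CompactSpace ((𝓡∂ (n + 1)).boundary W) := compactSpace_boundary n W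
  have hgM : (Cobordism.ofBoundary n W).IsMorseFunction g := hg.1
  have hgA : IsMorseAdapted (𝓡∂ (n + 1)) (M := (Cobordism.ofBoundary n W).W) g :=
    hgM.isMorseAdapted_ofBoundary
  have hgd : MDifferentiable (𝓡∂ (n + 1)) 𝓘(ℝ, ℝ) g :=
    hgM.isMorse.contMDiff.mdifferentiable (by simp)
  -- the critical points: `p₀` of index `0`, the finite set `P` of index `1`, no other
  set K : Set (Cobordism.ofBoundary n W).W := criticalSet (𝓡∂ (n + 1)) g with hK
  have hKfin : K.Finite :=
    IsMorse.finite_criticalSet_holds (I := 𝓡∂ (n + 1)) (M := (Cobordism.ofBoundary n W).W)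
      hgM.isMorse
  obtain ⟨p₀, hp₀⟩ : ∃ p₀, criticalSetOfIndex (𝓡∂ (n + 1)) g 0 = {p₀} := Set.ncard_eq_one.1 h0
  have hp₀mem : p₀ ∈ criticalSetOfIndex (𝓡∂ (n + 1)) g 0 := by rw [hp₀]; exact mem_singleton p₀
  have hp₀crit : IsMCriticalPt (𝓡∂ (n + 1)) g p₀ := hp₀mem.1
  have hp₀idx : morseIndex (𝓡∂ (n + 1)) g p₀ = 0 := hp₀mem.2
  set P : Set (Cobordism.ofBoundary n W).W := criticalSetOfIndex (𝓡∂ (n + 1)) g 1 with hP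
  have hidx : ∀ z ∈ K, morseIndex (𝓡∂ (n + 1)) g z = 0 ∨ morseIndex (𝓡∂ (n + 1)) g z = 1 := by
    intro z hz
    by_contra hne
    push Not at hne
    have h2le : 2 ≤ morseIndex (𝓡∂ (n + 1)) g z := by omega
    have hfin' : (criticalSetOfIndex (𝓡∂ (n + 1)) g (morseIndex (𝓡∂ (n + 1)) g z)).Finite :=
      hKfin.subset (criticalSetOfIndex_subset _ g _)
    have hzero : (criticalSetOfIndex (𝓡∂ (n + 1)) g (morseIndex (𝓡∂ (n + 1)) g z)).ncard = 0 :=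
      h2 _ h2le
    have hmem : z ∈ criticalSetOfIndex (𝓡∂ (n + 1)) g (morseIndex (𝓡∂ (n + 1)) g z) := ⟨hz, rfl⟩
    rw [(Set.ncard_eq_zero hfin').1 hzero] at hmem
    exact hmem
  have huniq : ∀ q, IsMCriticalPt (𝓡∂ (n + 1)) g q → morseIndex (𝓡∂ (n + 1)) g q = 0 → q = p₀ := by
    intro q hq hq0
    have : q ∈ criticalSetOfIndex (𝓡∂ (n + 1)) g 0 := ⟨hq, hq0⟩
    rw [hp₀] at this
    exact this
  have hKcases : ∀ z ∈ K, z = p₀ ∨ z ∈ P := fun z hz =>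
    (hidx z hz).imp (huniq z hz) fun h => ⟨hz, h⟩
  -- critical values
  have hval₀ : g p₀ = Cobordism.niceLevel n 0 := (hg.2 p₀ hp₀crit).trans (congrArg _ hp₀idx)
  have hval₁ : ∀ q ∈ P, g q = Cobordism.niceLevel n 1 := fun q hq =>
    (hg.2 q hq.1).trans (congrArg _ hq.2)
  have hKlt1 : ∀ z ∈ K, g z < 1 := fun z hz => (hgM.apply_mem_Ioo_of_mem_criticalSet hz).2
  -- the ball `B = {g ≤ t₁}` just above `p₀`
  obtain ⟨r₀, hr₀, hr₀1, hcritval, hballs⟩ :=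
    hgA.exists_continuousMap_closedBall_range_eq_sublevel hp₀crit huniq hp₀idx
  obtain ⟨β, hβinj, hβrange⟩ := hballs r₀ hr₀ le_rfl
  set t₁ : ℝ := g p₀ + r₀ ^ 2 with ht₁
  have ht₁p₀ : g p₀ < t₁ := by rw [ht₁]; nlinarith
  have ht₁pos : 0 < t₁ := (Cobordism.niceLevel_pos n 0).trans_le (hval₀ ▸ ht₁p₀.le)
  have ht₁1 : t₁ < 1 := hr₀1
  have ht₁P : ∀ q ∈ P, t₁ < g q := fun q hq =>
    hcritval q hq.1 fun h => by
      have := hq.2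
      rw [h, hp₀idx] at this
      exact zero_ne_one this
  have hgpos : ∀ z, 0 < g z := fun z => by
    rcases (𝓡∂ (n + 1)).isInteriorPoint_or_isBoundaryPoint z with hz | hz
    · exact (hgM.2.2.2.2 z hz).1
    · rw [(hgA.2.1 z hz).1]; exact one_pos
  have hB : range β = g ⁻¹' Icc 0 t₁ := by
    rw [hβrange]
    ext z
    simp only [mem_preimage, mem_Iic, mem_Icc, iff_and_self]
    exact fun _ => (hgpos z).le
  -- Thm. 3.14 on the slab `[t₁, 1]`, glued to the identity of the ball
  have hreg : ∀ z ∈ K, g z ≠ t₁ ∧ g z ≠ 1 := by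
    intro z hz
    refine ⟨fun h => ?_, (hKlt1 z hz).ne⟩
    rcases hKcases z hz with rfl | hzP
    · exact ht₁p₀.ne h
    · exact (ht₁P z hzP).ne' h
  have hlev : ∀ z ∈ K, ∀ z' ∈ K, g z ∈ Ioo t₁ 1 → g z' ∈ Ioo t₁ 1 → g z = g z' := by
    intro z hz z' hz' hzI hz'I
    rcases hKcases z hz with rfl | hzP
    · exact absurd hzI.1 (not_lt.2 ht₁p₀.le)
    rcases hKcases z' hz' with rfl | hz'P
    · exact absurd hz'I.1 (not_lt.2 ht₁p₀.le)
    rw [hval₁ z hzP, hval₁ z' hz'P]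
  set S₁ : Set (Cobordism.ofBoundary n W).W := g ⁻¹' Icc 0 t₁ with hS₁
  set P' : Set (Cobordism.ofBoundary n W).W := K ∩ g ⁻¹' Ioo t₁ 1 with hP'
  set D : (Cobordism.ofBoundary n W).W → Set (Cobordism.ofBoundary n W).W := fun p =>
    leftHandDisc (𝓡∂ (n + 1)) g ξ p t₁ with hD
  have hP'P : P' = P := by
    apply Subset.antisymm
    · rintro z ⟨hz, hzI⟩
      rcases hKcases z hz with rfl | hzP
      · exact absurd hzI.1 (not_lt.2 ht₁p₀.le)
      · exact hzP
    · intro z hzP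
      exact ⟨hzP.1, ht₁P z hzP, hKlt1 z hzP.1⟩
  have hS₂univ : g ⁻¹' Icc 0 1 = univ := eq_univ_of_forall fun z => ⟨(hgpos z).le, hgA.le_one z⟩
  have hDval : ∀ p ∈ P', ∀ x ∈ D p, t₁ ≤ g x ∧ g x ≤ g p := fun p _ x hx =>
    ⟨hx.2, hξ.apply_le_of_mem_stableSet hgd hx.1⟩
  have key : Homotopy.IsStrongDeformationRetractOf (S₁ ∪ ⋃ p ∈ P', D p) (g ⁻¹' Icc 0 1) :=
    Cobordism.isStrongDeformationRetractOf_sublevel_union_leftHandDiscs hgM ξ hξ le_rfl ht₁pos.le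
      ht₁1 le_rfl hreg hlev
  -- the left-hand discs are disjoint arcs attached to the ball along their end points
  have hFinP : Fintype ↥P := (hKfin.subset (criticalSetOfIndex_subset _ g _)).fintype
  have hPmem : ∀ q : ↥P, (q : (Cobordism.ofBoundary n W).W) ∈ P' := fun q => by rw [hP'P]; exact q.2
  have hnoval : ∀ p ∈ P', ∀ z ∈ K, g z ∉ Ico t₁ (g p) := by
    intro p hp z hz hzI
    have hzt : g z ∈ Ioo t₁ 1 :=
      ⟨lt_of_le_of_ne hzI.1 (hreg z hz).1.symm, hzI.2.trans hp.2.2⟩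
    exact (hlev z hz p hp.1 hzt hp.2 ▸ hzI.2).false
  -- the arcs, parametrised by the closed unit ball of `ℝ¹`
  have hdim : ∀ q : ↥P, morseIndex (𝓡∂ (n + 1)) g (q : (Cobordism.ofBoundary n W).W) = 1 :=
    fun q => q.2.2
  have harc : ∀ q : ↥P, ∃ Φ : C(closedBall (0 : EuclideanSpace ℝ (Fin 1)) 1, (Cobordism.ofBoundary n W).W),
      Injective Φ ∧
      range Φ = D q ∧ ∀ x, g (Φ x) = t₁ ↔ ‖(x : EuclideanSpace ℝ (Fin 1))‖ = 1 := by
    intro q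
    obtain ⟨Φ, hΦinj, hΦrange, hΦlev⟩ :=
      Cobordism.Milnor1965_leftHandDisc_isDisc_holds hgM ξ hξ ht₁pos.le (hPmem q).1 (hPmem q).2.1
        (hnoval _ (hPmem q))
    -- transport along `Fin (morseIndex g q) = Fin 1`
    have e := hdim q
    revert Φ
    rw [e]
    intro Φ hΦinj hΦrange hΦlev
    exact ⟨Φ, hΦinj, hΦrange, hΦlev⟩
  choose Φ hΦinj hΦrange hΦlev using harc
  have hv : ContMDiff (𝓡∂ (n + 1)) (𝓡∂ (n + 1)).tangent 1
      (fun y ↦ (⟨y, ξ y⟩ : TangentBundle (𝓡∂ (n + 1)) (Cobordism.ofBoundary n W).W)) :=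
    ξ.contMDiff.of_le (WithTop.coe_le_coe.mpr le_top)
  have hmem : ∀ (q : ↥P) x, Φ q x ∈ range β ↔ ‖x.1‖ = 1 := by
    intro q x
    rw [← hΦlev q x, hB]
    have hxD : Φ q x ∈ D q := by
      have h := mem_range_self (f := Φ q) x
      rw [hΦrange q] at h
      exact h
    constructor
    · intro hx
      exact le_antisymm hx.2 (hDval q (hPmem q) _ hxD).1
    · intro hx
      exact ⟨ht₁pos.le.trans_eq hx.symm, hx.le⟩
  have hdisj : Pairwise fun p q : ↥P => Disjoint (range (Φ p)) (range (Φ q)) := by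
    intro p q hpq
    rw [hΦrange p, hΦrange q]
    exact (disjoint_stableSet hv (Subtype.coe_ne_coe.mpr hpq)).mono inter_subset_left
      inter_subset_left
  have hunion : range β ∪ ⋃ p : ↥P, range (Φ p) = S₁ ∪ ⋃ p ∈ P', D p := by
    rw [hB]
    congr 1
    ext x
    simp only [mem_iUnion]
    constructor
    · rintro ⟨p, hx⟩
      rw [hΦrange p] at hx
      exact ⟨p, hPmem p, hx⟩
    · rintro ⟨p, hp, hx⟩
      have hp' : p ∈ P := by rw [← hP'P]; exact hp
      refine ⟨⟨p, hp'⟩, ?_⟩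
      rw [hΦrange ⟨p, hp'⟩]
      exact hx
  have hcard : Fintype.card ↥P = m := by
    rw [← h1, Set.ncard_eq_toFinset_card', Set.toFinset_card]
  have hsdr : Homotopy.IsStrongDeformationRetractOf (range β ∪ ⋃ p : ↥P, range (Φ p)) univ := by
    rw [hunion, ← hS₂univ]
    exact key
  have hB' : range β = g ⁻¹' Iic t₁ := hβrange
  refine ⟨p₀, t₁, β, hFinP, Φ, hp₀, ht₁p₀, ht₁pos, ht₁1, ht₁P, hβinj, hB', hcard, hΦinj, hΦrange,
    hΦlev, hmem, hdisj, hsdr⟩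

end Literature.Topology.FourManifolds
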